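import Summits.KontsevichZagierPeriods.Zeta5Search.WellPoisedFaceTailLive
import Summits.KontsevichZagierPeriods.Zeta5Search.WellPoisedFaceOddGrowthFree
import HarnessLib

/-!
# Odd-zeta search — [Zudilin2004, Lemma 19] on the numerator-free face, part 11b: EVERY integral direction
# (tails in any order, every number of bricks; cell `pub-zeta5`, fam-vwp gen 9)

HONEST FRAMING: systematic search; no irrationality claim unless certified.

Part 11a (`WellPoisedFaceTailLive`) proved Lemma 19 with the sharp denominator and the `Φ⁻¹` saving for every
`M ≥ 1` and SORTED tails, with the live window `liveWindow (M+2) (η₀n)` of zeta values.  An `IntFaceDir M` only lists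
its smallest tail first and its largest last (the middle ones in any order), so this part removes `Monotone E.tail`:

* `IntFaceDir.sorted` — the same `η₀`, the tails sorted (`Tuple.sort`); `F(h_n)`, `Φ(h_n)`, `D(n)` and `Λ_n` are
  symmetric in the tail bricks (part 11a's `tailF_comp_perm`, `PhiQ_comp_perm`; `faceD_eq_sq_mul_prod`), hence the
  same for `E` and `E.sorted`: `sorted_faceForm`, `sorted_facePhi`, `sorted_faceD`, `sorted_faceLambda`.
* **THE THEOREMS** `IntFaceDir.faceD_mul_faceForm_mem` (every `n`) and `IntFaceDir.faceLambda_faceForm_mem`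
  (`(M+1)² ≤ η₀ n + 2`): for EVERY integral face direction `E : IntFaceDir M`, `M ≥ 1`, the normalised face form
  `Λ_n = D(n) · Φ(h_n)⁻¹ · F(h_n)` (`E.faceLambda E.faceForm n` of `WellPoisedFaceOddGrowthFree`) is
  `Σ_{s ∈ liveWindow (M+2) (η₀n)} a_s ζ(s) − b` with `a_s, b ∈ ℤ`.  Corollaries by parity: `faceLambda_faceForm_mem_odd`
  (even `M`: file 10's statement with `Monotone` dropped), `…_odd_of_oddMul` (`η₀ n` odd), `…_even` (odd `M`, `η₀ n`
  even: NO odd zeta value occurs).  `faceLambda_faceForm_final`: for `1 ≤ M ≤ 6` (the boxes `6 ≤ q ≤ 11`) these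
  integer forms in the live zeta values tend to `+∞` in absolute value (fam-odd gen 8's growth theorem).
* Kernel instances: the `q = 9` model shape with SHUFFLED middle tails `(93; 0³, 22, 31, 25, 34, 28, 37)` (window
  `{ζ5, ζ7}`, integer coefficients, every `n ≥ 1`); the `q = 8` direction `(51; 0³, 15, 16, 17, 18, 19)` of fam-odd 15,
  whose INTEGER forms alternate between `ℤ + ℤζ(5) + ℤζ(7)` (`n` odd) and `ℤ + ℤζ(4) + ℤζ(6)` (`n` even).

## What is NOT proved here
Anything about any `ζ(s)`: the forms GROW (`faceLambda_faceForm_tendsto_atTop`, `M ≤ 6`; for `M ≥ 7` no growth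
statement is in the tree), so their integrality is Lemma 19's bookkeeping and no more.  The finitely many `n` with
`η₀ n + 2 < (M+1)²` (primes `p ≤ M + 1` inside `Φ`) are left out of the `Φ⁻¹` statement.  The interior (Lemma 20,
saddle-point) regime of the boxes is untouched.

References: [Zudilin2004, Lemma 19, (8.6)–(8.10)]; [BallRivoal2001]; [Rivoal2000, Lemme 1].
-/

noncomputable section

open Finset Filter

namespace Summit.KontsevichZagierPeriods.Zeta5Search.WellPoisedFace.IntFaceDir

open Literature.NumberTheory.Transcendental (zetaValue)
open Summit.KontsevichZagierPeriods.Zeta5Search.WellPoisedFaceRate (tailF liveWindow liveWindow_of_even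
  liveWindow_of_oddMul liveWindow_of_odd_even tailF_comp_perm)

variable {M : ℕ} (E : IntFaceDir M) (n : ℕ)

/-! ## 1. Sorting the tails: `D(n)`, `Φ(h_n)`, `F(h_n)`, `Λ_n` do not see the order of the tail bricks -/

/-- The direction with the same `η₀` and the same tails listed increasingly (`Tuple.sort`). -/
def sorted : IntFaceDir M where
  η₀ := E.η₀
  tail := E.tail ∘ Tuple.sort E.tail
  hlo j := Tuple.monotone_sort E.tail (Fin.zero_le _)
  hhi j := Tuple.monotone_sort E.tail (Fin.le_last _)
  hd := by
    show 2 * E.tail (Tuple.sort E.tail (Fin.last (M + 1))) < E.η₀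
    have h1 := E.hhi (Tuple.sort E.tail (Fin.last (M + 1)))
    have h2 := E.hd
    omega

/-- `E.sorted` has the `η₀` of `E` … -/
theorem sorted_η₀ : E.sorted.η₀ = E.η₀ := rfl

/-- … the tails of `E` read through the sorting permutation … -/
theorem sorted_tail_apply (j : Fin (M + 2)) : E.sorted.tail j = E.tail (Tuple.sort E.tail j) := rfl

/-- … which are sorted. -/
theorem sorted_monotone : Monotone E.sorted.tail := Tuple.monotone_sort E.tail

/-- The smallest tail is still `η₄ = E.tail 0` … -/
theorem sorted_tail_zero : E.sorted.tail 0 = E.tail 0 := by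
  rw [sorted_tail_apply]
  refine le_antisymm ?_ (E.hlo _)
  have h := E.sorted_monotone (Fin.zero_le ((Tuple.sort E.tail).symm 0))
  rw [sorted_tail_apply, sorted_tail_apply, Equiv.apply_symm_apply] at h
  exact h

/-- … and the largest is still `η_q = E.tail (last)`. -/
theorem sorted_tail_last : E.sorted.tail (Fin.last (M + 1)) = E.tail (Fin.last (M + 1)) := by
  rw [sorted_tail_apply]
  refine le_antisymm (E.hhi _) ?_
  have h := E.sorted_monotone (Fin.le_last ((Tuple.sort E.tail).symm (Fin.last (M + 1))))
  rw [sorted_tail_apply, sorted_tail_apply, Equiv.apply_symm_apply] at h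
  exact h

/-- Hence the same `a = η₄` … -/
theorem sorted_a : E.sorted.a = E.a := E.sorted_tail_zero

/-- … the same Lemma-19 exponents `μ` … -/
theorem sorted_mu : E.sorted.mu = E.mu := by
  funext x
  unfold mu
  rw [sorted_a, sorted_η₀]

/-- … the same `h₀ = η₀ n + 2` … -/
theorem sorted_h0 : E.sorted.h0 n = E.h0 n := rfl

/-- … the tail parameters `h_{3+j}` permuted … -/
theorem sorted_hT : E.sorted.hT n = E.hT n ∘ Tuple.sort E.tail := rfl

/-- … with the same `h₄` … -/
theorem sorted_hT_zero : E.sorted.hT n 0 = E.hT n 0 := by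
  unfold hT
  rw [sorted_tail_zero]

/-- … and the same `h_q` … -/
theorem sorted_hT_last : E.sorted.hT n (Fin.last (M + 1)) = E.hT n (Fin.last (M + 1)) := by
  unfold hT
  rw [sorted_tail_last]

/-- … so the same top exponent `M_{q−3}` (the prime range of `Φ`). -/
theorem sorted_faceMZ_last : E.sorted.faceMZ n (Fin.last (M + 1)) = E.faceMZ n (Fin.last (M + 1)) := by
  unfold faceMZ
  rw [sorted_hT_zero, sorted_hT_last, sorted_h0]

/-- **`Φ(h_n)` is the same for `E` and `E.sorted`.** -/
theorem sorted_facePhi : E.sorted.facePhi n = E.facePhi n := by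
  unfold facePhi
  rw [sorted_faceMZ_last, sorted_hT_zero, sorted_h0, sorted_hT, PhiQ_comp_perm]

/-- `D(n) = D_{μ(η₄)n}² · ∏_{all tails j} D_{μ(η_j)n}` (the cube on the smallest tail split as square × its factor). -/
theorem faceD_eq_sq_mul_prod :
    E.faceD n = Nat.lcmUpto (E.mu (E.tail 0) * n) ^ 2 * ∏ j, Nat.lcmUpto (E.mu (E.tail j) * n) := by
  unfold faceD
  simp only [faceMZ_toNat]
  rw [Fin.prod_univ_succ, Fin.prod_univ_castSucc]
  simp only [Fin.succ_castSucc, Fin.succ_last]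
  ring

/-- **`D(n)` is the same for `E` and `E.sorted`.** -/
theorem sorted_faceD : E.sorted.faceD n = E.faceD n := by
  rw [faceD_eq_sq_mul_prod, faceD_eq_sq_mul_prod, sorted_mu, sorted_tail_zero]
  congr 1
  exact Fintype.prod_equiv (Tuple.sort E.tail) _ _ fun j => rfl

/-- **`Λ_n(F)` is the same for `E` and `E.sorted`** (any `F`). -/
theorem sorted_faceLambda (F : ℕ → ℝ) : E.sorted.faceLambda F n = E.faceLambda F n := by
  unfold faceLambda
  rw [sorted_faceD, sorted_facePhi]

/-- **`F(h_n)` is the same for `E` and `E.sorted`.** -/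
theorem sorted_faceForm : E.sorted.faceForm = E.faceForm := by
  funext n
  exact tailF_comp_perm E.η₀ E.tail n (Tuple.sort E.tail)

/-! ## 2. THE THEOREMS: every `M ≥ 1`, every integral direction -/

/-- **THEOREM (Lemma 19's sharp denominator on the numerator-free face, kernel, general).**  For EVERY integral
face direction `E : IntFaceDir M` (`q = M + 5 ≥ 6`, tails in any order) and every `n`:
`D(n) · F(h_n) = Σ_{s ∈ liveWindow (M+2) (η₀n)} a_s ζ(s) − b` with `a_s, b ∈ ℤ`
(`D(n) = D_{M₁}³D_{M₂}⋯D_{M_{M+2}}`, `F(h_n) = E.faceForm n`). -/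
theorem faceD_mul_faceForm_mem (hM1 : 1 ≤ M) (n : ℕ) :
    ∃ a : ℕ → ℤ, ∃ b : ℤ, (E.faceD n : ℝ) * E.faceForm n
      = (∑ s ∈ liveWindow (M + 2) (E.η₀ * n), (a s : ℝ) * zetaValue s) - (b : ℝ) := by
  obtain ⟨a, b, h⟩ := E.sorted.faceD_mul_tailF_mem_live E.sorted_monotone hM1 n
  refine ⟨a, b, ?_⟩
  rw [← E.sorted_faceD n, ← E.sorted_faceForm]
  exact h

/-- **THEOREM ([Zudilin2004, Lemma 19] on the numerator-free face, kernel, general).**  For EVERY integral face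
direction `E : IntFaceDir M` (`M ≥ 1`, tails in any order) and every `n` with `(M+1)² ≤ η₀ n + 2`, the normalised
face form `Λ_n = D(n) · Φ(h_n)⁻¹ · F(h_n)` (`E.faceLambda E.faceForm n`) satisfies
`Λ_n = Σ_{s ∈ liveWindow (M+2) (η₀n)} a_s ζ(s) − b`, `a_s, b ∈ ℤ`.  The forms grow (`faceLambda_faceForm_final`):
this is NOT a statement about any `ζ(s)`. -/
theorem faceLambda_faceForm_mem (hM1 : 1 ≤ M) (hn : (M + 1) ^ 2 ≤ E.η₀ * n + 2) :
    ∃ a : ℕ → ℤ, ∃ b : ℤ, E.faceLambda E.faceForm n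
      = (∑ s ∈ liveWindow (M + 2) (E.η₀ * n), (a s : ℝ) * zetaValue s) - (b : ℝ) := by
  obtain ⟨a, b, h⟩ := E.sorted.faceLambda_tailF_mem_live n E.sorted_monotone hM1 hn
  refine ⟨a, b, ?_⟩
  rw [← E.sorted_faceLambda, ← E.sorted_faceForm]
  exact h

/-- Even `M` (the boxes `q = 9, 11, …`): the ODD window `{ζ(5), …, ζ(M+3)}` — file 10's theorem with the
sortedness hypothesis removed. -/
theorem faceLambda_faceForm_mem_odd (hM1 : 1 ≤ M) (hMe : Even M) (hn : (M + 1) ^ 2 ≤ E.η₀ * n + 2) :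
    ∃ a : ℕ → ℤ, ∃ b : ℤ, E.faceLambda E.faceForm n
      = (∑ s ∈ (Ioc 3 (M + 4)).filter Odd, (a s : ℝ) * zetaValue s) - (b : ℝ) := by
  obtain ⟨a, b, h⟩ := E.faceLambda_faceForm_mem n hM1 hn
  exact ⟨a, b, by rw [h, liveWindow_of_even (hMe.add even_two), show M + 2 + 2 = M + 4 from rfl]⟩

/-- `η₀ n` odd (`h₀` odd): the ODD window, for every `M ≥ 1` — in particular on the even-`q` boxes (`M` odd). -/
theorem faceLambda_faceForm_mem_odd_of_oddMul (hM1 : 1 ≤ M) (hN : Odd (E.η₀ * n))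
    (hn : (M + 1) ^ 2 ≤ E.η₀ * n + 2) :
    ∃ a : ℕ → ℤ, ∃ b : ℤ, E.faceLambda E.faceForm n
      = (∑ s ∈ (Ioc 3 (M + 4)).filter Odd, (a s : ℝ) * zetaValue s) - (b : ℝ) := by
  obtain ⟨a, b, h⟩ := E.faceLambda_faceForm_mem n hM1 hn
  exact ⟨a, b, by rw [h, liveWindow_of_oddMul hN, show M + 2 + 2 = M + 4 from rfl]⟩

/-- Odd `M` (the boxes `q = 8, 10, …`) and `η₀ n` even (`h₀` even): the EVEN window `{ζ(4), ζ(6), …, ζ(M+3)}` —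
integer forms in the EVEN zeta values only; the odd ones have dropped out. -/
theorem faceLambda_faceForm_mem_even (hMo : Odd M) (hN : Even (E.η₀ * n)) (hn : (M + 1) ^ 2 ≤ E.η₀ * n + 2) :
    ∃ a : ℕ → ℤ, ∃ b : ℤ, E.faceLambda E.faceForm n
      = (∑ s ∈ (Ioc 3 (M + 4)).filter Even, (a s : ℝ) * zetaValue s) - (b : ℝ) := by
  obtain ⟨a, b, h⟩ := E.faceLambda_faceForm_mem n hMo.pos hn
  exact ⟨a, b, by rw [h, liveWindow_of_odd_even (hMo.add_even even_two) hN, show M + 2 + 2 = M + 4 from rfl]⟩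

/-- **SUMMARY (the numerator-free faces of the boxes `6 ≤ q ≤ 11`, kernel).**  For every integral direction
(`1 ≤ M ≤ 6`, any order of the tails): the normalised forms `Λ_n = D(n)Φ(h_n)⁻¹F(h_n)` are, as soon as
`(M+1)² ≤ η₀ n + 2`, INTEGER linear forms in `1` and the zeta values of the live window, and `|Λ_n| → +∞`
(fam-odd gen 8's `faceLambda_faceForm_tendsto_atTop`).  Growing integer forms: nothing follows about any `ζ(s)`. -/
theorem faceLambda_faceForm_final (hM1 : 1 ≤ M) (hM6 : M ≤ 6) :
    (∀ n, (M + 1) ^ 2 ≤ E.η₀ * n + 2 → ∃ a : ℕ → ℤ, ∃ b : ℤ, E.faceLambda E.faceForm n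
        = (∑ s ∈ liveWindow (M + 2) (E.η₀ * n), (a s : ℝ) * zetaValue s) - (b : ℝ)) ∧
      Tendsto (fun n : ℕ => |E.faceLambda E.faceForm n|) atTop atTop :=
  ⟨fun n hn => E.faceLambda_faceForm_mem n hM1 hn, E.faceLambda_faceForm_tendsto_atTop hM1 hM6⟩

/-! ## 3. Kernel instances -/

/-- The `q = 9` model shape of fam-odd 5 with its middle tails SHUFFLED: `(93; 0³, 22, 31, 25, 34, 28, 37)` — an
integral face direction (smallest tail first, largest last, the middle ones in any order) outside files 9b/10. -/
def modelFace9Shuffled : IntFaceDir 4 where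
  η₀ := 93
  tail := ![22, 31, 25, 34, 28, 37]
  hlo := by decide
  hhi := by decide
  hd := by decide

/-- Its tails are NOT sorted (so files 9b/10 do not apply to it directly) … -/
example : ¬Monotone modelFace9Shuffled.tail := fun h => absurd (h (show (1 : Fin 6) ≤ 2 by decide)) (by decide)

/-- … yet `Λ_n = a₅ζ(5) + a₇ζ(7) − b` with `a₅, a₇, b ∈ ℤ` for every `n ≥ 1` (window `{ζ5, ζ7}`; the forms grow):
its sorted rearrangement is the model shape `(93; 0³, 22, 25, 28, 31, 34, 37)` with the same `D(n)`, `Φ`, `F`. -/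
example (n : ℕ) (hn : 1 ≤ n) : ∃ a : ℕ → ℤ, ∃ b : ℤ, modelFace9Shuffled.faceLambda modelFace9Shuffled.faceForm n
    = (a 5 : ℝ) * zetaValue 5 + (a 7 : ℝ) * zetaValue 7 - (b : ℝ) := by
  obtain ⟨a, b, h⟩ := modelFace9Shuffled.faceLambda_faceForm_mem_odd n (by norm_num) ⟨2, rfl⟩
    (by show (4 + 1) ^ 2 ≤ 93 * n + 2; omega)
  refine ⟨a, b, ?_⟩
  rw [h, show (Ioc 3 (4 + 4)).filter Odd = {5, 7} by decide, sum_pair (by norm_num)]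

/-- The `q = 8` direction `(51; 0³, 15, 16, 17, 18, 19)` (five tail bricks, `M = 3` odd; fam-odd 15's `face8Int`,
there with RATIONAL coefficients and the frame denominator). -/
def face8Dir : IntFaceDir 3 where
  η₀ := 51
  tail := ![15, 16, 17, 18, 19]
  hlo := by decide
  hhi := by decide
  hd := by decide

/-- `n` odd (`h₀ = 51n + 2` odd): `Λ_n = a₅ζ(5) + a₇ζ(7) − b`, `a₅, a₇, b ∈ ℤ` … -/
example (n : ℕ) (hn : Odd n) : ∃ a : ℕ → ℤ, ∃ b : ℤ, face8Dir.faceLambda face8Dir.faceForm n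
    = (a 5 : ℝ) * zetaValue 5 + (a 7 : ℝ) * zetaValue 7 - (b : ℝ) := by
  obtain ⟨a, b, h⟩ := face8Dir.faceLambda_faceForm_mem_odd_of_oddMul n (by norm_num)
    ((by decide : Odd 51).mul hn) (by show (3 + 1) ^ 2 ≤ 51 * n + 2; have := hn.pos; omega)
  refine ⟨a, b, ?_⟩
  rw [h, show (Ioc 3 (3 + 4)).filter Odd = {5, 7} by decide, sum_pair (by norm_num)]

/-- … `n ≥ 2` even (`h₀` even): `Λ_n = a₄ζ(4) + a₆ζ(6) − b ∈ ℤ + ℤζ(4) + ℤζ(6)` — no odd zeta value at all.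
(`|Λ_n| → +∞` along all `n`: `faceLambda_faceForm_final` with `M = 3`.) -/
example (n : ℕ) (hn : Even n) (h1 : 1 ≤ n) : ∃ a : ℕ → ℤ, ∃ b : ℤ, face8Dir.faceLambda face8Dir.faceForm n
    = (a 4 : ℝ) * zetaValue 4 + (a 6 : ℝ) * zetaValue 6 - (b : ℝ) := by
  obtain ⟨a, b, h⟩ := face8Dir.faceLambda_faceForm_mem_even n ⟨1, rfl⟩ (hn.mul_left 51)
    (by show (3 + 1) ^ 2 ≤ 51 * n + 2; omega)
  refine ⟨a, b, ?_⟩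
  rw [h, show (Ioc 3 (3 + 4)).filter Even = {4, 6} by decide, sum_pair (by norm_num)]

end Summit.KontsevichZagierPeriods.Zeta5Search.WellPoisedFace.IntFaceDir
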